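import Literature.IUT.HodgeTheaters.GlobalFrobenioidsRealifyUniversal
import Literature.AlgebraicGeometry.Frobenioids.ArithmeticDivisorsPerfectionPrimes
import Literature.AlgebraicGeometry.Frobenioids.ArithmeticDivisorsPerfFactorial
import Literature.AlgebraicGeometry.Frobenioids.PerfFactorialSupport
import Literature.AlgebraicGeometry.Frobenioids.PerfFactorialPrimes
import Literature.AlgebraicGeometry.Frobenioids.RealificationMapInjectiveFiniteSupp
import Mathlib.Algebra.BigOperators.Pi
import HarnessLib

/-!
# [IUTchI] Example 3.5 (i) ↔ [FrdI] Def 2.4 (i) / Ex 6.3: the primes of `Φ(L)^pf` versus the places, read on the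
# intrinsic realification `Φ(L)^rlf` (PROOF-ONLY; part 1 of the identification `Φ(L)^rlf ≃ Φ_{𝒞⊩_mod}`)

Mochizuki, *Inter-universal Teichmüller theory I*, §3, Example 3.5 (i), kurims manuscript (May 2020) p. 84
([IUTchI] Ex 3.5 (i) p.84) [claim: Mochizuki2012, status: disputed]: "`Φ_{𝒞⊩_mod,v} ≅ ord(𝒪^▷_{(F_mod)_v})^pf ⊗ ℝ_{≥0}`"
(one `ℝ_{≥0}`-coordinate per place `v`); and Mochizuki, *The geometry of Frobenioids I*, Kyushu J. Math. **62** (2008),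
Def 2.4 (i) p. 48 (`M^rlf ⊆ ∏_𝔮 M^rlf_𝔮`, `Supp`), Ex 6.3 p. 113 ("there is a natural bijection `Prime(Φ(L)) ≃ V(L)`").

PROOF-ONLY (no `def`, no instance; abc-iut-w4-d073 gen 4).  Notation: `Φ(L) = EffArithDivisor L` (abc-iut-L1),
`Φ(L)^rlf = (EffArithDivisor.isPerfFactorial L).Rlf` (abc-iut-L1's intrinsic realification), `ι : Φ(L) → Φ(L)^pf → Φ(L)^rlf`
(`toRealification ∘ Perfection.of`), `δ_v = EffArithDivisor.single L v` the generator at the place `v`, `𝔮_v = [ι δ_v]`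
the prime of `Φ(L)^pf` at `v` (a bijection `V(L) ≃ Prime(Φ(L)^pf)`, `EffArithDivisor.pfPrimeOf_bijective`, abc-iut-L6-t10),
`realifyMod = EffArithDivisor.realifyMod L : Φ(L) → Φ_{𝒞⊩_mod} = (V(L) →₀ ℝ_{≥0})` (abc-iut-w4-d050).  This file proves the
dictionary used by `GlobalFrobenioidsRealifyRlfEquiv.lean`:
* `realifyMod_single_apply_of_ne` / `_self_ne_zero` — `realifyMod(δ_v)` is the nonzero multiple `1/e_v` (resp. `1`)
  of the unit vector at `v`;
* `degree_ext_single`, `degree_eq_mul_realifyMod_apply` — an additive `Φ(L) → ℝ_{≥0}` is determined by its values on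
  the `δ_v`; if it vanishes on all `δ_w`, `w ≠ v`, it is a multiple of the `v`-coordinate of `realifyMod`;
* `EffArithDivisor.supp_iota_single`, `iota_apply_pfPrimeOf_ne_one_iff`, `iota_single_apply_ne_one/_eq_one` —
  `Supp(ι δ_v) = {𝔮_v}`, and `𝔮_v ∈ Supp(ι a)` iff the `v`-coefficient of `a` is nonzero;
* `EffArithDivisor.supp_coe_rlf_finite` — every element of `Φ(L)^rlf` is finitely supported;
* `IsPerfFactorial.rlf_eq_single_of_supp_subset` — an element of `M^rlf` supported inside `{𝔮}` is the one-prime element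
  with its own `𝔮`-component (any perf-factorial `M`).
No new Prop fact; no statement of the paper is strengthened; no side is taken on [IUTchIII] Cor. 3.12.
-/

noncomputable section

open scoped Classical NNReal

namespace Literature.IUT.HodgeTheaters

open Function NumberField Literature.AlgebraicGeometry.Frobenioids Literature.AnabelianGeometry.EtaleTheta

variable (L : Type) [Field L] [NumberField L]


/-! ### The generators `δ_v` of `Φ(L)` and their `realifyMod`-coordinates -/

/-- The archimedean generator `δ_w = (0, 1_w)`. ([IUTchI] Ex 3.5 (i) p.84) [claim: Mochizuki2012, status: disputed] -/
theorem EffArithDivisor.single_inl_eq (w : InfinitePlace L) :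
    EffArithDivisor.single L (Sum.inl w) = ((0, Pi.single w 1) : EffArithDivisor L) := by
  refine Prod.ext rfl (funext fun w' => ?_)
  change (if w' = w then (1 : ℝ≥0) else 0) = (Pi.single w (1 : ℝ≥0) : InfinitePlace L → ℝ≥0) w'
  by_cases h : w' = w
  · subst h; rw [if_pos rfl, Pi.single_eq_same]
  · rw [if_neg h, Pi.single_eq_of_ne h]

/-- The support of an effective arithmetic divisor is finite (finitely many archimedean places; a `Finsupp` at the
finite places). ([IUTchI] Ex 3.5 (i) p.84) [claim: Mochizuki2012, status: disputed] -/
theorem EffArithDivisor.psupp_finite (D : EffArithDivisor L) : (EffArithDivisor.psupp D).Finite := by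
  refine ((Set.finite_range (Sum.inl : InfinitePlace L → Places L)).union
    (D.1.support.finite_toSet.image Sum.inr)).subset ?_
  rintro (w | v) hv
  · exact Or.inl ⟨w, rfl⟩
  · exact Or.inr ⟨v, by simpa [Finsupp.mem_support_iff] using hv, rfl⟩

/-- `realifyMod(δ_v)` vanishes away from `v`. ([IUTchI] Ex 3.5 (i) p.84) [claim: Mochizuki2012, status: disputed] -/
theorem realifyMod_single_apply_of_ne {v v' : Places L} (h : v' ≠ v) :
    EffArithDivisor.realifyMod L (EffArithDivisor.single L v) v' = 0 := by
  rcases v with w | u <;> rcases v' with w' | u'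
  · rw [realifyMod_apply_inl, EffArithDivisor.single_inl_eq]
    exact Pi.single_eq_of_ne (fun h' => h (congrArg Sum.inl h')) _
  · rw [realifyMod_apply_inr, EffArithDivisor.single_inl_eq]
    simp
  · rw [realifyMod_apply_inl]
    rfl
  · rw [realifyMod_apply_inr]
    change ((Finsupp.single u 1 u' : ℕ) : ℝ≥0) * _ = 0
    have hne : u' ≠ u := fun h' => h (congrArg Sum.inr h')
    rw [Finsupp.single_apply, if_neg (Ne.symm hne), Nat.cast_zero, zero_mul]

/-- `realifyMod(δ_v)` has a NONZERO `v`-coordinate (`1/e_v` at a finite `v`, `1` at an archimedean `v`).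
([IUTchI] Ex 3.5 (i) p.84) [claim: Mochizuki2012, status: disputed] -/
theorem realifyMod_single_apply_self_ne_zero (v : Places L) :
    EffArithDivisor.realifyMod L (EffArithDivisor.single L v) v ≠ 0 := by
  rcases v with w | u
  · rw [realifyMod_apply_inl, EffArithDivisor.single_inl_eq]
    simp
  · rw [realifyMod_apply_inr]
    change ((Finsupp.single u 1 u : ℕ) : ℝ≥0) * _ ≠ 0
    rw [Finsupp.single_eq_same, Nat.cast_one, one_mul]
    exact inv_ne_zero (absRamIdx_cast_ne_zero L u)

/-! ### `ℝ_{≥0}`-valued degrees on `Φ(L)` are determined by their values on the generators -/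

/-- Two additive maps `Φ(L) → ℝ_{≥0}` that agree on every generator `δ_v` are equal (the archimedean rays carry
only homotheties, `degree_arch_single`). ([IUTchI] Ex 3.5 (i) p.84) [claim: Mochizuki2012, status: disputed] -/
theorem degree_ext_single {D₁ D₂ : EffArithDivisor L →+ ℝ≥0}
    (h : ∀ v : Places L, D₁ (EffArithDivisor.single L v) = D₂ (EffArithDivisor.single L v)) : D₁ = D₂ := by
  have hfin : D₁.comp (AddMonoidHom.inl _ _) = D₂.comp (AddMonoidHom.inl _ _) := by
    refine Finsupp.addHom_ext fun u n => ?_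
    change D₁ (Finsupp.single u n, 0) = D₂ (Finsupp.single u n, 0)
    rw [degree_fin_single L D₁, degree_fin_single L D₂]
    exact congrArg (n • ·) (h (Sum.inr u))
  have harc : D₁.comp (AddMonoidHom.inr _ _) = D₂.comp (AddMonoidHom.inr _ _) := by
    refine AddMonoidHom.functions_ext _ _ _ fun w x => ?_
    change D₁ (0, Pi.single w x) = D₂ (0, Pi.single w x)
    rw [degree_arch_single L D₁, degree_arch_single L D₂]
    have hw := h (Sum.inl w)
    rw [EffArithDivisor.single_inl_eq] at hw
    rw [hw]
  refine AddMonoidHom.ext fun x => ?_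
  have h1 := DFunLike.congr_fun hfin x.1
  have h2 := DFunLike.congr_fun harc x.2
  simp only [AddMonoidHom.comp_apply, AddMonoidHom.inl_apply, AddMonoidHom.inr_apply] at h1 h2
  rw [← Prod.fst_add_snd x, map_add, map_add, h1, h2]

/-- An additive `D : Φ(L) → ℝ_{≥0}` vanishing on every generator except `δ_v` is the multiple
`(D(δ_v) / realifyMod(δ_v)_v) ·` of the `v`-coordinate of `realifyMod`. ([IUTchI] Ex 3.5 (i) p.84)
[claim: Mochizuki2012, status: disputed] -/
theorem degree_eq_mul_realifyMod_apply {D : EffArithDivisor L →+ ℝ≥0} (v : Places L)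
    (h : ∀ w : Places L, w ≠ v → D (EffArithDivisor.single L w) = 0) (a : EffArithDivisor L) :
    D a = D (EffArithDivisor.single L v) / EffArithDivisor.realifyMod L (EffArithDivisor.single L v) v *
      EffArithDivisor.realifyMod L a v := by
  let D' : EffArithDivisor L →+ ℝ≥0 :=
    (AddMonoidHom.mulLeft
      (D (EffArithDivisor.single L v) / EffArithDivisor.realifyMod L (EffArithDivisor.single L v) v)).comp
      ((Finsupp.applyAddHom v).comp (EffArithDivisor.realifyMod L))
  have hD' : ∀ b, D' b = D (EffArithDivisor.single L v) / EffArithDivisor.realifyMod L (EffArithDivisor.single L v) v *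
      EffArithDivisor.realifyMod L b v := fun _ => rfl
  suffices hDD : D = D' by rw [← hD', ← hDD]
  refine degree_ext_single L fun w => ?_
  rw [hD']
  by_cases hw : w = v
  · subst hw
    rw [div_mul_cancel₀ _ (realifyMod_single_apply_self_ne_zero L w)]
  · rw [h w hw, realifyMod_single_apply_of_ne L (Ne.symm hw), mul_zero]

/-! ### The primes of `Φ(L)^pf` versus the places: supports of the factorizations `ι(a)` -/

/-- `Supp(ι δ_v) = {𝔮_v}`: the factorization of the generator at `v` is supported exactly at the prime `[δ_v]` of
`Φ(L)^pf`. ([IUTchI] Ex 3.5 (i) p.84) [claim: Mochizuki2012, status: disputed] -/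
theorem EffArithDivisor.supp_iota_single (v : Places L) :
    supp (((EffArithDivisor.isPerfFactorial L).toRealification
        (Perfection.of _ (Multiplicative.ofAdd (EffArithDivisor.single L v))) :
          (EffArithDivisor.isPerfFactorial L).Rlf) : RlfFactor (Multiplicative (EffArithDivisor L))) =
      {Quotient.mk (primarySetoid _) ⟨_, EffArithDivisor.isPrimary_of_single L v⟩} :=
  IsPerfFactorial.Rlf.supp_toRealification_of_mem_carrier _ (mem_carrier_mk_of_isPrimary _)

/-- **`𝔮_v ∈ Supp(ι a)` iff `v ∈ supp(a)`** (`a ∈ Φ(L)`): the `𝔮_v`-component of the factorization of `ι(a)` is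
nonzero exactly when the `v`-coefficient of `a` is nonzero. ([IUTchI] Ex 3.5 (i) p.84) [claim: Mochizuki2012, status: disputed] -/
theorem EffArithDivisor.iota_apply_pfPrimeOf_ne_one_iff (v : Places L) (a : EffArithDivisor L) :
    (((EffArithDivisor.isPerfFactorial L).toRealification (Perfection.of _ (Multiplicative.ofAdd a)) :
          (EffArithDivisor.isPerfFactorial L).Rlf) : RlfFactor (Multiplicative (EffArithDivisor L)))
        (Quotient.mk (primarySetoid _) ⟨_, EffArithDivisor.isPrimary_of_single L v⟩) ≠ 1 ↔
      v ∈ EffArithDivisor.psupp a := by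
  have key := (EffArithDivisor.isPerfFactorial L).mem_supp_factorMap_of_iff (Multiplicative.ofAdd a)
    (Quotient.mk (primarySetoid _) ⟨_, EffArithDivisor.isPrimary_single v⟩)
  rw [Primes.perfectionEquiv_mk _ _ _ (EffArithDivisor.isPrimary_of_single L v)] at key
  refine Iff.trans Iff.rfl (key.trans ?_)
  constructor
  · rintro ⟨a₀, ha₀, hle⟩
    have h1 : Multiplicative.ofAdd (EffArithDivisor.single L v) ≼ a₀ :=
      Primes.precsim_of_mem_carrier _ (mem_carrier_mk_of_isPrimary _) ha₀
    have h2 := EffArithDivisor.precsim_iff_psupp_subset.mp (h1.trans hle)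
    rw [EffArithDivisor.psupp_single, Set.singleton_subset_iff] at h2
    exact h2
  · intro hv
    refine ⟨_, mem_carrier_mk_of_isPrimary (EffArithDivisor.isPrimary_single v), ?_⟩
    rw [EffArithDivisor.precsim_iff_psupp_subset, EffArithDivisor.psupp_single, Set.singleton_subset_iff]
    exact hv

/-- **Every element of `Φ(L)^rlf` has finite support** (its support lies in `Supp(ι a) ⊆ {𝔮_v : v ∈ supp a}` for
some `a ∈ Φ(L)`): realified arithmetic divisors are finitely supported. ([IUTchI] Ex 3.5 (i) p.84)
[claim: Mochizuki2012, status: disputed] -/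
theorem EffArithDivisor.supp_coe_rlf_finite (x : (EffArithDivisor.isPerfFactorial L).Rlf) :
    (supp (x : RlfFactor (Multiplicative (EffArithDivisor L)))).Finite := by
  obtain ⟨b, hb⟩ := ((EffArithDivisor.isPerfFactorial L).mem_realification_iff _).mp x.2
  obtain ⟨⟨a, n⟩, rfl⟩ := Perfection.mk_surjective b
  dsimp only at hb
  have hsupp : supp (factorMap _ (Perfection.mk a n)) =
      supp (factorMap _ (Perfection.of (Multiplicative (EffArithDivisor L)) a)) := by
    rw [← Perfection.mk_pow_self a n, ← (EffArithDivisor.isPerfFactorial L).factorHom_apply,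
      ← (EffArithDivisor.isPerfFactorial L).factorHom_apply, map_pow, supp_pow _ n.pos]
  rw [hsupp] at hb
  refine Set.Finite.subset ?_ hb
  refine ((EffArithDivisor.psupp_finite L (Multiplicative.toAdd a)).image fun v : Places L =>
    (Quotient.mk (primarySetoid _) ⟨_, EffArithDivisor.isPrimary_of_single L v⟩ :
      Literature.AlgebraicGeometry.Frobenioids.Primes (Perfection (Multiplicative (EffArithDivisor L))))).subset ?_
  intro 𝔮 h𝔮
  obtain ⟨v, rfl⟩ := (EffArithDivisor.pfPrimeOf_bijective L).2 𝔮
  exact ⟨v, (EffArithDivisor.iota_apply_pfPrimeOf_ne_one_iff L v (Multiplicative.toAdd a)).mp h𝔮, rfl⟩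

/-- An element of `M^rlf` supported inside `{𝔮}` is the one-prime element with its own `𝔮`-component (any
perf-factorial `M`). ([IUTchI] Ex 3.5 (i) p.84) [claim: Mochizuki2012, status: disputed] -/
theorem IsPerfFactorial.rlf_eq_single_of_supp_subset {M : Type} [CommMonoid M] (hM : IsPerfFactorial M) {x : hM.Rlf}
    {𝔮 : Literature.AlgebraicGeometry.Frobenioids.Primes (Perfection M)} (h : supp (x : RlfFactor M) ⊆ {𝔮}) :
    x = hM.single 𝔮 ((x : RlfFactor M) 𝔮) := by
  apply Subtype.ext
  funext 𝔮'
  rw [IsPerfFactorial.coe_single]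
  by_cases h' : 𝔮' = 𝔮
  · subst h'
    rw [IsPerfFactorial.single'_apply_same]
  · rw [IsPerfFactorial.single'_apply_of_ne h']
    by_contra hne
    exact h' (h hne)

/-- `ι(δ_v)` is the one-prime element at `𝔮_v` with its own `𝔮_v`-component. ([IUTchI] Ex 3.5 (i) p.84)
[claim: Mochizuki2012, status: disputed] -/
theorem EffArithDivisor.iota_single_eq_rlfSingle (v : Places L) :
    (EffArithDivisor.isPerfFactorial L).toRealification
        (Perfection.of _ (Multiplicative.ofAdd (EffArithDivisor.single L v))) =
      (EffArithDivisor.isPerfFactorial L).single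
        (Quotient.mk (primarySetoid _) ⟨_, EffArithDivisor.isPrimary_of_single L v⟩)
        ((((EffArithDivisor.isPerfFactorial L).toRealification
            (Perfection.of _ (Multiplicative.ofAdd (EffArithDivisor.single L v))) :
            (EffArithDivisor.isPerfFactorial L).Rlf) : RlfFactor (Multiplicative (EffArithDivisor L)))
          (Quotient.mk (primarySetoid _) ⟨_, EffArithDivisor.isPrimary_of_single L v⟩)) :=
  IsPerfFactorial.rlf_eq_single_of_supp_subset (EffArithDivisor.isPerfFactorial L) (EffArithDivisor.supp_iota_single L v).le

/-- The `𝔮_v`-component of `ι(δ_v)` is nonzero. ([IUTchI] Ex 3.5 (i) p.84) [claim: Mochizuki2012, status: disputed] -/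
theorem EffArithDivisor.iota_single_apply_ne_one (v : Places L) :
    (((EffArithDivisor.isPerfFactorial L).toRealification
        (Perfection.of _ (Multiplicative.ofAdd (EffArithDivisor.single L v))) :
        (EffArithDivisor.isPerfFactorial L).Rlf) : RlfFactor (Multiplicative (EffArithDivisor L)))
      (Quotient.mk (primarySetoid _) ⟨_, EffArithDivisor.isPrimary_of_single L v⟩) ≠ 1 := by
  have hmem : (Quotient.mk (primarySetoid _) ⟨_, EffArithDivisor.isPrimary_of_single L v⟩ :
      Literature.AlgebraicGeometry.Frobenioids.Primes (Perfection (Multiplicative (EffArithDivisor L)))) ∈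
      supp (((EffArithDivisor.isPerfFactorial L).toRealification
        (Perfection.of _ (Multiplicative.ofAdd (EffArithDivisor.single L v))) :
        (EffArithDivisor.isPerfFactorial L).Rlf) : RlfFactor (Multiplicative (EffArithDivisor L))) := by
    rw [EffArithDivisor.supp_iota_single L v]; exact Set.mem_singleton _
  exact hmem

/-- Away from `𝔮_v` the components of `ι(δ_w)` (`w ≠ v`) are trivial. ([IUTchI] Ex 3.5 (i) p.84)
[claim: Mochizuki2012, status: disputed] -/
theorem EffArithDivisor.iota_single_apply_eq_one {v w : Places L} (hw : w ≠ v) :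
    (((EffArithDivisor.isPerfFactorial L).toRealification
        (Perfection.of _ (Multiplicative.ofAdd (EffArithDivisor.single L w))) :
        (EffArithDivisor.isPerfFactorial L).Rlf) : RlfFactor (Multiplicative (EffArithDivisor L)))
      (Quotient.mk (primarySetoid _) ⟨_, EffArithDivisor.isPrimary_of_single L v⟩) = 1 := by
  by_contra hne
  have hmem : (Quotient.mk (primarySetoid _) ⟨_, EffArithDivisor.isPrimary_of_single L v⟩ :
      Literature.AlgebraicGeometry.Frobenioids.Primes (Perfection (Multiplicative (EffArithDivisor L)))) ∈
      supp (((EffArithDivisor.isPerfFactorial L).toRealification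
        (Perfection.of _ (Multiplicative.ofAdd (EffArithDivisor.single L w))) :
        (EffArithDivisor.isPerfFactorial L).Rlf) : RlfFactor (Multiplicative (EffArithDivisor L))) := hne
  rw [EffArithDivisor.supp_iota_single L w] at hmem
  exact hw ((EffArithDivisor.pfPrimeOf_bijective L).1 (Set.eq_of_mem_singleton hmem)).symm

end Literature.IUT.HodgeTheaters

end
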